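import Summits.CriticalPhenomena.PercolationContinuityZ3.Theorems.PercNearOneGluingAdditiveGluingBlockPeel
import Summits.CriticalPhenomena.PercolationContinuityZ3.Theorems.PercNearOneGluingAdditiveGluingFingerPeel
import HarnessLib

/-! # Crux `PercNearOneGluing.AdditiveGluing` (stmt-CriticalPhenomena-4576) — peeling a contact relay that is BASE-above the
# designation needs no hypothesis (seat (b) V⁺-form, depth prover `png-dp-vplus`)

Support file (`--supports stmt-CriticalPhenomena-4576`); no definitions, no named facts.  Companion of `…AdditiveGluingBlockPeel.lean`
(`block_multiEdge_peel`: peeling the contacts at a relay `a` costs the `{d ↮ N}`-restricted comparison `μ_g(M ∩ d↔b) ≤ μ_g(M ∩ a↔b)`) and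
`…AdditiveGluingFingerPeel.lean` (`fingerML3_peel`, where that comparison is bought with the stub's unglued hypothesis at `a`).

Here the restricted comparison is obtained from the BASE alone:

* `glue_restricted_of_base` — `g` any weighting, `F` a set of contact pairs of the block `N` (pairs `s(v,a')`, `v ∈ N`, `a' ∉ N`), `w₀ = pinW g F ∅`
  the base (contacts killed), `d ∉ N`.  If `μ_{w₀}(d↔b) ≤ μ_{w₀}(a↔b)` then `μ_g(M ∩ d↔b) ≤ μ_g(M ∩ a↔b)`, `M = {d ↮ N}`.  Proof: decompose
  `μ_g` over the patterns `J ⊆ F` (`prodBernoulli_real_inter_eq_sum_pinW`); the pattern weighting `pinW g F J` is `w₀` with the pairs of `J`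
  glued, i.e. the push-forward of `μ_{w₀}` under `ω ↦ ω ∪ J` (`glueSet_pushforward`); the pull-back of `M ∩ {d↔b}` is `M_J ∩ {d↔b}` with
  `M_J = {d ↮ N ∪ (endpoints of J)}` (`reachable_of_union_of_avoids`: a walk from `d` cannot use an added pair without first reaching one of
  its endpoints), a decreasing event read on the cluster of `d`, which Kozma–Nitzan's Lemma 3(ii) in `w₀` compares with the pull-back of
  `M ∩ {a↔b}`.
* `block_multiEdge_peel_base`, `fingerML3_peel_base` — hence a contact relay that is base-above `d` is peeled WITHOUT any hypothesis
  (block and stub vocabularies).  With `fingerML3_peel` (hypothesis at the relay) these are the free moves of the peel calculus; what remains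
  of `stub_fingerML3_vp` is the case of two or more contact relays base-below `d` that support each other.
[cite: KozmaNitzan2024, Lemma 3(ii) (pp. 6–7), §3.1 (gluing), §3.2 pp. 12–14]
-/

namespace Summit.CriticalPhenomena.PercolationContinuityZ3.Theorems

open MeasureTheory Set
open Literature.Probability.LatticeModels (prodBernoulli)
open Literature.Probability.Percolation (BondConfig openConn openGraph openEdgeCluster pinW localCylinder
  DeterminedBy determinedBy_iff)

noncomputable section
open Classical

section BasePeel

open ProbabilityTheory Literature.Probability.LatticeModels Literature.Probability.Percolation

variable {n : ℕ}

/-! ### Gluing an arbitrary set of pairs is a push-forward -/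

/-- The coin of `e` under `w`, mapped by `P ↦ P ∨ (e ∈ D)`, is the coin of `e` under a weighting `w'` glued along `D`
(`w' = 1` on `D`, `w' = w` off `D`). [folklore] -/
theorem glueSet_map_coin (w w' : Sym2 (Fin n) → unitInterval) (D : Set (Sym2 (Fin n)))
    (h1 : ∀ e ∈ D, w' e = 1) (h2 : ∀ e ∉ D, w' e = w e) (e : Sym2 (Fin n)) :
    (Ber(True, False, w e)).map (fun P : Prop => P ∨ e ∈ D) = Ber(True, False, w' e) := by
  rw [map_bernoulliMeasure]
  by_cases hD : e ∈ D
  · have ha : (True ∨ e ∈ D) = True := propext (iff_true_intro (Or.inr hD))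
    have hb : (False ∨ e ∈ D) = True := propext (iff_true_intro (Or.inr hD))
    simp only [ha, hb, h1 e hD, bernoulliMeasure_self_eq_dirac, bernoulliMeasure_one]
  · have ha : (True ∨ e ∈ D) = True := propext (iff_true_intro (Or.inl trivial))
    have hb : (False ∨ e ∈ D) = False := propext (iff_false_intro (by rintro (h | h); exacts [h, hD h]))
    simp only [ha, hb, h2 e hD]

/-- **Gluing a set of pairs `D` is the push-forward of `prodBernoulli w` under `ω ↦ ω ∪ D`**: for any weighting `w'` with `w' = 1` on `D`
and `w' = w` off `D`, `μ_{w'}(E) = μ_w{ω | ω ∪ D ∈ E}`. [folklore; Grimmett 1999 §1.3; KozmaNitzan2024 §3.1] -/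
theorem glueSet_pushforward (w w' : Sym2 (Fin n) → unitInterval) (D : Set (Sym2 (Fin n)))
    (h1 : ∀ e ∈ D, w' e = 1) (h2 : ∀ e ∉ D, w' e = w e) (E : Set (BondConfig (Fin n))) :
    (prodBernoulli w').real E = (prodBernoulli w).real {ω : BondConfig (Fin n) | (ω ∪ D : BondConfig (Fin n)) ∈ E} := by
  have hmap : (prodBernoulli w).map (fun ω : BondConfig (Fin n) => (ω ∪ D : BondConfig (Fin n))) = prodBernoulli w' :=
    sigmaLaw_prodBernoulli_map_coordwise w w' (fun (e : Sym2 (Fin n)) (P : Prop) => P ∨ e ∈ D)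
      (glueSet_map_coin w w' D h1 h2)
  have hmeas : Measurable fun ω : BondConfig (Fin n) => (ω ∪ D : BondConfig (Fin n)) := Measurable.of_discrete
  rw [measureReal_def, measureReal_def, ← hmap, Measure.map_apply hmeas MeasurableSet.of_discrete]
  rfl

/-! ### Adding pairs inside a set the cluster of `d` avoids -/

/-- If the cluster of `d` avoids `X` in `ω` and every pair of `D` has all its endpoints in `X`, then every vertex reachable from `d` in
`ω ∪ D` is reachable from `d` in `ω`: a walk from `d` cannot use a pair of `D` without first reaching `X`. [folklore] -/
theorem reachable_of_union_of_avoids {ω : BondConfig (Fin n)} {X : Set (Fin n)} {D : Set (Sym2 (Fin n))} {d : Fin n}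
    (hD : ∀ e ∈ D, ∀ x ∈ e, x ∈ X) (hM : ∀ x ∈ X, ¬ (openGraph ω).Reachable d x) {y : Fin n}
    (h : (openGraph (ω ∪ D : BondConfig (Fin n))).Reachable d y) : (openGraph ω).Reachable d y := by
  obtain ⟨p⟩ := h
  suffices key : ∀ (u v : Fin n) (q : (openGraph (ω ∪ D : BondConfig (Fin n))).Walk u v),
      (openGraph ω).Reachable d u → (openGraph ω).Reachable d v from key d y p (SimpleGraph.Reachable.refl _)
  intro u v q
  induction q with
  | nil => exact id
  | cons hadj q ih =>
    intro hu
    refine ih ?_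
    rename_i u' w' _
    obtain ⟨hmem, hne⟩ := (openGraph_adj _ u' w').1 hadj
    rcases hmem with hω | hD'
    · exact hu.trans ((openGraph_adj ω u' w').2 ⟨hω, hne⟩).reachable
    · exact (hM u' (hD _ hD' u' (Sym2.mem_mk_left u' w')) hu).elim

/-- **The pull-back of `{d ↮ N} ∩ {d ↔ b}` under `ω ↦ ω ∪ J`**, `J` a set of contact pairs (`s(v,a')`, `v ∈ N`): it is
`{d ↮ X_J} ∩ {d ↔ b}` with `X_J = N ∪ (endpoints of J)`. [folklore] -/
theorem union_preimage_avoids_inter_openConn (N : Finset (Fin n)) (J : Finset (Sym2 (Fin n)))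
    (hJ : ∀ e ∈ J, ∃ v ∈ N, ∃ a' ∉ N, e = s(v, a')) (d b : Fin n) :
    {ω : BondConfig (Fin n) | (ω ∪ (↑J : Set (Sym2 (Fin n))) : BondConfig (Fin n)) ∈
        ({ω : BondConfig (Fin n) | ∀ x ∈ (↑N : Set (Fin n)), ¬ (openGraph ω).Reachable d x} ∩ openConn d b)} =
      {ω : BondConfig (Fin n) | ∀ x ∈ ({x : Fin n | x ∈ N ∨ ∃ e ∈ J, x ∈ e} : Set (Fin n)), ¬ (openGraph ω).Reachable d x} ∩
        openConn d b := by
  have hall : ∀ e ∈ (↑J : Set (Sym2 (Fin n))), ∀ x ∈ e, x ∈ ({x : Fin n | x ∈ N ∨ ∃ e ∈ J, x ∈ e} : Set (Fin n)) :=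
    fun e he x hx => Or.inr ⟨e, Finset.mem_coe.1 he, hx⟩
  ext ω
  simp only [Set.mem_setOf_eq, Set.mem_inter_iff, Finset.mem_coe]
  constructor
  · rintro ⟨hM', hdb'⟩
    have hX : ∀ x ∈ ({x : Fin n | x ∈ N ∨ ∃ e ∈ J, x ∈ e} : Set (Fin n)), ¬ (openGraph ω).Reachable d x := by
      rintro x (hxN | ⟨e, heJ, hxe⟩) hdx
      · exact hM' x hxN (hdx.mono (SimpleGraph.fromEdgeSet_mono Set.subset_union_left))
      · obtain ⟨v, hvN, a', ha'N, rfl⟩ := hJ e heJ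
        have hva : v ≠ a' := fun h => ha'N (h ▸ hvN)
        -- `d` reaches `x ∈ {v, a'}` in `ω`, hence `v ∈ N` in `ω ∪ J` through the pair `s(v,a')`
        have hreach : (openGraph (ω ∪ (↑J : Set (Sym2 (Fin n))) : BondConfig (Fin n))).Reachable d v := by
          have hdx' : (openGraph (ω ∪ (↑J : Set (Sym2 (Fin n))) : BondConfig (Fin n))).Reachable d x :=
            hdx.mono (SimpleGraph.fromEdgeSet_mono Set.subset_union_left)
          rcases Sym2.mem_iff.1 hxe with rfl | rfl
          · exact hdx'
          · have hadj : (openGraph (ω ∪ (↑J : Set (Sym2 (Fin n))) : BondConfig (Fin n))).Adj x v :=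
              (openGraph_adj _ x v).2 ⟨Or.inr (Finset.mem_coe.2 (by rw [Sym2.eq_swap]; exact heJ)), hva.symm⟩
            exact hdx'.trans hadj.reachable
        exact hM' v hvN hreach
    exact ⟨hX, reachable_of_union_of_avoids hall hX hdb'⟩
  · rintro ⟨hX, hdb⟩
    refine ⟨fun x hxN hdx => hX x (Or.inl hxN) (reachable_of_union_of_avoids hall hX hdx), ?_⟩
    exact (show (openGraph ω).Reachable d b from hdb).mono (SimpleGraph.fromEdgeSet_mono Set.subset_union_left)

/-- The pull-back of `{d ↮ N} ∩ {a ↔ b}` under `ω ↦ ω ∪ J` contains `{d ↮ X_J} ∩ {a ↔ b}`. [folklore] -/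
theorem union_preimage_avoids_inter_openConn_superset (N : Finset (Fin n)) (J : Finset (Sym2 (Fin n)))
    (hJ : ∀ e ∈ J, ∃ v ∈ N, ∃ a' ∉ N, e = s(v, a')) (d a b : Fin n) :
    {ω : BondConfig (Fin n) | ∀ x ∈ ({x : Fin n | x ∈ N ∨ ∃ e ∈ J, x ∈ e} : Set (Fin n)), ¬ (openGraph ω).Reachable d x} ∩
        openConn a b ⊆
      {ω : BondConfig (Fin n) | (ω ∪ (↑J : Set (Sym2 (Fin n))) : BondConfig (Fin n)) ∈
        ({ω : BondConfig (Fin n) | ∀ x ∈ (↑N : Set (Fin n)), ¬ (openGraph ω).Reachable d x} ∩ openConn a b)} := by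
  have hall : ∀ e ∈ (↑J : Set (Sym2 (Fin n))), ∀ x ∈ e, x ∈ ({x : Fin n | x ∈ N ∨ ∃ e ∈ J, x ∈ e} : Set (Fin n)) :=
    fun e he x hx => Or.inr ⟨e, Finset.mem_coe.1 he, hx⟩
  have _ := hJ
  rintro ω ⟨hX, hab⟩
  simp only [Set.mem_setOf_eq, Set.mem_inter_iff, Finset.mem_coe]
  refine ⟨fun x hxN hdx => hX x (Or.inl hxN) (reachable_of_union_of_avoids hall hX hdx), ?_⟩
  exact (show (openGraph ω).Reachable a b from hab).mono (SimpleGraph.fromEdgeSet_mono Set.subset_union_left)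

/-! ### The restricted comparison from the base comparison -/

/-- **Restricted comparison in any weighting from the BASE comparison.**  `g` any weighting; `F` a set of contact pairs of the block `N`
(pairs `s(v,a')`, `v ∈ N`, `a' ∉ N`); `w₀ = pinW g F ∅` (contacts killed); `d ∉ N`; `M = {d ↮ N}`.  If `μ_{w₀}(d↔b) ≤ μ_{w₀}(a↔b)` then
`μ_g(M ∩ {d↔b}) ≤ μ_g(M ∩ {a↔b})`.  [cite: KozmaNitzan2024, Lemma 3(ii) (pp. 6–7), §3.1] -/
theorem glue_restricted_of_base (g : Sym2 (Fin n) → unitInterval) (N : Finset (Fin n)) (F : Finset (Sym2 (Fin n)))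
    (hF : ∀ e ∈ F, ∃ v ∈ N, ∃ a' ∉ N, e = s(v, a')) (d a b : Fin n)
    (hle : (prodBernoulli (pinW g (↑F : Set (Sym2 (Fin n))) ↑(∅ : Finset (Sym2 (Fin n))))).real (openConn d b) ≤
      (prodBernoulli (pinW g (↑F : Set (Sym2 (Fin n))) ↑(∅ : Finset (Sym2 (Fin n))))).real (openConn a b)) :
    (prodBernoulli g).real
        ({ω : BondConfig (Fin n) | ∀ x ∈ (↑N : Set (Fin n)), ¬ (openGraph ω).Reachable d x} ∩ openConn d b) ≤
      (prodBernoulli g).real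
        ({ω : BondConfig (Fin n) | ∀ x ∈ (↑N : Set (Fin n)), ¬ (openGraph ω).Reachable d x} ∩ openConn a b) := by
  set M : Set (BondConfig (Fin n)) :=
    {ω : BondConfig (Fin n) | ∀ x ∈ (↑N : Set (Fin n)), ¬ (openGraph ω).Reachable d x} with hM
  set w₀ : Sym2 (Fin n) → unitInterval := pinW g (↑F : Set (Sym2 (Fin n))) ↑(∅ : Finset (Sym2 (Fin n))) with hw₀
  have hmeas : ∀ s : Set (BondConfig (Fin n)), MeasurableSet s := fun _ => MeasurableSet.of_discrete
  -- pattern decomposition of both sides over `F`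
  -- per-pattern comparison, summed over the patterns of `F` (split along `R` = some contact open, to use the pattern sum)
  set R : Set (BondConfig (Fin n)) := {ω : Set (Sym2 (Fin n)) | ∃ e ∈ F, e ∈ ω} with hR
  have hdetR : DeterminedBy R (↑F : Set (Sym2 (Fin n))) := DepthOneGluing.determinedBy_exists_mem F
  have hdetRc : DeterminedBy Rᶜ (↑F : Set (Sym2 (Fin n))) := determinedBy_forall_not_mem F
  suffices hJ : ∀ J : Finset (Sym2 (Fin n)), J ⊆ F →
      (prodBernoulli (pinW g ↑F ↑J)).real (M ∩ openConn d b) ≤ (prodBernoulli (pinW g ↑F ↑J)).real (M ∩ openConn a b) by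
    have hs1 := measureReal_inter_add_sdiff (μ := prodBernoulli g) (s := M ∩ openConn d b) (hmeas R)
    have hs2 := measureReal_inter_add_sdiff (μ := prodBernoulli g) (s := M ∩ openConn a b) (hmeas R)
    rw [Set.sdiff_eq] at hs1 hs2
    have h1 := prodBernoulli_real_inter_eq_sum_pinW g F (A := M ∩ openConn d b) (B := R) (hmeas _) hdetR
    have h2 := prodBernoulli_real_inter_eq_sum_pinW g F (A := M ∩ openConn a b) (B := R) (hmeas _) hdetR
    have h3 := prodBernoulli_real_inter_eq_sum_pinW g F (A := M ∩ openConn d b) (B := Rᶜ) (hmeas _) hdetRc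
    have h4 := prodBernoulli_real_inter_eq_sum_pinW g F (A := M ∩ openConn a b) (B := Rᶜ) (hmeas _) hdetRc
    have hle1 : (prodBernoulli g).real ((M ∩ openConn d b) ∩ R) ≤ (prodBernoulli g).real ((M ∩ openConn a b) ∩ R) := by
      rw [h1, h2]
      refine Finset.sum_le_sum fun J hJm => mul_le_mul_of_nonneg_left ?_ measureReal_nonneg
      exact hJ J (Finset.mem_powerset.1 ((@Finset.mem_filter _ _ (_) _ _).1 hJm).1)
    have hle2 : (prodBernoulli g).real ((M ∩ openConn d b) ∩ Rᶜ) ≤ (prodBernoulli g).real ((M ∩ openConn a b) ∩ Rᶜ) := by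
      rw [h3, h4]
      refine Finset.sum_le_sum fun J hJm => mul_le_mul_of_nonneg_left ?_ measureReal_nonneg
      exact hJ J (Finset.mem_powerset.1 ((@Finset.mem_filter _ _ (_) _ _).1 hJm).1)
    linarith
  intro J hJF
  have hJ' : ∀ e ∈ J, ∃ v ∈ N, ∃ a' ∉ N, e = s(v, a') := fun e he => hF e (hJF he)
  -- the pattern weighting is `w₀` glued along `J`
  have hp1 : ∀ e ∈ (↑J : Set (Sym2 (Fin n))), pinW g (↑F : Set (Sym2 (Fin n))) ↑J e = 1 :=
    fun e he => pinW_apply_of_mem_of_mem g (Finset.mem_coe.2 (hJF (Finset.mem_coe.1 he))) he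
  have hp2 : ∀ e ∉ (↑J : Set (Sym2 (Fin n))), pinW g (↑F : Set (Sym2 (Fin n))) ↑J e = w₀ e := by
    intro e he
    rw [hw₀]
    by_cases heF : e ∈ (↑F : Set (Sym2 (Fin n)))
    · rw [pinW_apply_of_mem_of_not_mem g heF he, pinW_apply_of_mem_of_not_mem g heF (by simp)]
    · rw [pinW_apply_of_not_mem g _ heF, pinW_apply_of_not_mem g _ heF]
  set XJ : Set (Fin n) := {x : Fin n | x ∈ N ∨ ∃ e ∈ J, x ∈ e} with hXJ
  have h3 : (prodBernoulli w₀).real ({ω : BondConfig (Fin n) | ∀ x ∈ XJ, ¬ (openGraph ω).Reachable d x} ∩ openConn d b) ≤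
      (prodBernoulli w₀).real ({ω : BondConfig (Fin n) | ∀ x ∈ XJ, ¬ (openGraph ω).Reachable d x} ∩ openConn a b) := by
    have h := KozmaNitzan2024_lemma3_ii_notConn w₀ d a b XJ hle
    rw [Set.inter_comm (openConn d b), Set.inter_comm (openConn a b)] at h
    exact h
  rw [glueSet_pushforward w₀ _ ↑J hp1 hp2 (M ∩ openConn d b), glueSet_pushforward w₀ _ ↑J hp1 hp2 (M ∩ openConn a b),
    union_preimage_avoids_inter_openConn N J hJ' d b]
  exact h3.trans (measureReal_mono (union_preimage_avoids_inter_openConn_superset N J hJ' d a b))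

/-- **Peeling a base-strong contact relay (block vocabulary).**  As `block_multiEdge_peel`, with the restricted comparison replaced by the
base comparison `μ_{w₀}(d↔b) ≤ μ_{w₀}(a↔b)`, `w₀ = pinW g (F₁ ∪ F_a) ∅`.  [cite: KozmaNitzan2024, Lemma 3 (pp. 6–7), §3.2 pp. 12–14] -/
theorem block_multiEdge_peel_base (g : Sym2 (Fin n) → unitInterval) (N : Finset (Fin n)) (F₁ Fa : Finset (Sym2 (Fin n)))
    (a d b : Fin n) (hF₁ : ∀ e ∈ F₁, ∃ v ∈ N, ∃ a' ∉ N, e = s(v, a'))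
    (hFa : ∀ e ∈ Fa, ∃ v ∈ N, e = s(v, a)) (haN : a ∉ N) (hdN : d ∉ N) (hda : d ≠ a)
    (hle : (prodBernoulli (pinW g (↑(F₁ ∪ Fa) : Set (Sym2 (Fin n))) ↑(∅ : Finset (Sym2 (Fin n))))).real (openConn d b) ≤
      (prodBernoulli (pinW g (↑(F₁ ∪ Fa) : Set (Sym2 (Fin n))) ↑(∅ : Finset (Sym2 (Fin n))))).real (openConn a b))
    (hii : (prodBernoulli (pinW g (↑Fa : Set (Sym2 (Fin n))) (∅ : Set (Sym2 (Fin n))))).real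
        ({ω : Set (Sym2 (Fin n)) | ∃ e ∈ F₁, e ∈ ω} ∩ openConn d b) ≤
      (prodBernoulli (pinW g (↑Fa : Set (Sym2 (Fin n))) (∅ : Set (Sym2 (Fin n))))).real
        ({ω : Set (Sym2 (Fin n)) | ∃ e ∈ F₁, e ∈ ω} ∩ ⋃ s ∈ N, openConn s b)) :
    (prodBernoulli g).real ({ω : Set (Sym2 (Fin n)) | ∃ e ∈ F₁ ∪ Fa, e ∈ ω} ∩ openConn d b) ≤
      (prodBernoulli g).real ({ω : Set (Sym2 (Fin n)) | ∃ e ∈ F₁ ∪ Fa, e ∈ ω} ∩ ⋃ s ∈ N, openConn s b) := by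
  have hF : ∀ e ∈ F₁ ∪ Fa, ∃ v ∈ N, ∃ a' ∉ N, e = s(v, a') := by
    intro e he
    rcases Finset.mem_union.1 he with he | he
    · exact hF₁ e he
    · obtain ⟨v, hv, rfl⟩ := hFa e he
      exact ⟨v, hv, a, haN, rfl⟩
  have hrestr := glue_restricted_of_base g N (F₁ ∪ Fa) hF d a b hle
  exact block_multiEdge_peel g N F₁ Fa a d b hFa haN hdN hda hrestr hii

/-- **Peeling a base-strong relay (stub vocabulary).**  Finger/stub setting with `d, a ∈ A`, `a ≠ d`; `q` = `K` with every pair at `N`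
killed.  If `μ_q(d ↔ b) ≤ μ_q(a ↔ b)` (BASE comparison — no hypothesis in `K` or `K/N`) and FML3 holds for the relay set `A ∖ {a}` in
`K ⊖ (N–a)`, then FML3 holds for `A` in `K`.  [cite: KozmaNitzan2024, Lemma 3(ii) (pp. 6–7), §3.2 pp. 12–14] -/
theorem fingerML3_peel_base (K : Sym2 (Fin n) → unitInterval) (A N : Finset (Fin n)) (d a b : Fin n)
    (hNA : Disjoint N A) (hd : d ∈ A) (ha : a ∈ A) (hda : d ≠ a)
    (hfree : ∀ v ∈ N, ∀ y : Fin n, y ∉ A → y ∉ N → (K s(v, y) : ℝ) = 0)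
    (hle : (prodBernoulli (fun e' : Sym2 (Fin n) => if (∃ y ∈ e', y ∈ N) then (0 : unitInterval) else K e')).real (openConn d b) ≤
      (prodBernoulli (fun e' : Sym2 (Fin n) => if (∃ y ∈ e', y ∈ N) then (0 : unitInterval) else K e')).real (openConn a b))
    (hsub : (prodBernoulli (fun e' : Sym2 (Fin n) => if (∀ y ∈ e', y ∈ N) ∧ ¬ e'.IsDiag then 1 else
              if (∃ v ∈ N, e' = s(v, a)) then (0 : unitInterval) else K e')).real
          ({ω : Set (Sym2 (Fin n)) | ∃ v ∈ N, ∃ a' ∈ A.erase a, s(v, a') ∈ ω} ∩ openConn d b) ≤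
        (prodBernoulli (fun e' : Sym2 (Fin n) => if (∀ y ∈ e', y ∈ N) ∧ ¬ e'.IsDiag then 1 else
              if (∃ v ∈ N, e' = s(v, a)) then (0 : unitInterval) else K e')).real
          ({ω : Set (Sym2 (Fin n)) | ∃ v ∈ N, ∃ a' ∈ A.erase a, s(v, a') ∈ ω} ∩ ⋃ v ∈ N, openConn v b)) :
    (prodBernoulli (fun e' : Sym2 (Fin n) => if (∀ y ∈ e', y ∈ N) ∧ ¬ e'.IsDiag then 1 else K e')).real
        ({ω : Set (Sym2 (Fin n)) | ∃ v ∈ N, ∃ a' ∈ A, s(v, a') ∈ ω} ∩ openConn d b) ≤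
      (prodBernoulli (fun e' : Sym2 (Fin n) => if (∀ y ∈ e', y ∈ N) ∧ ¬ e'.IsDiag then 1 else K e')).real
        ({ω : Set (Sym2 (Fin n)) | ∃ v ∈ N, ∃ a' ∈ A, s(v, a') ∈ ω} ∩ ⋃ v ∈ N, openConn v b) := by
  set g : Sym2 (Fin n) → unitInterval := fun e' => if (∀ y ∈ e', y ∈ N) ∧ ¬ e'.IsDiag then 1 else K e' with hg
  set q : Sym2 (Fin n) → unitInterval := fun e' => if (∃ y ∈ e', y ∈ N) then (0 : unitInterval) else K e' with hq
  set Fa : Finset (Sym2 (Fin n)) := N.image (fun v => s(v, a)) with hFadef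
  set F₁ : Finset (Sym2 (Fin n)) := (N ×ˢ A.erase a).image (fun va : Fin n × Fin n => s(va.1, va.2)) with hF₁def
  set F : Finset (Sym2 (Fin n)) := (N ×ˢ A).image (fun va : Fin n × Fin n => s(va.1, va.2)) with hFdef
  have haN : a ∉ N := Finset.disjoint_left.1 hNA.symm ha
  have hdN : d ∉ N := Finset.disjoint_left.1 hNA.symm hd
  have hFa : ∀ e ∈ Fa, ∃ v ∈ N, e = s(v, a) := by
    intro e he
    obtain ⟨v, hv, rfl⟩ := Finset.mem_image.1 he
    exact ⟨v, hv, rfl⟩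
  have hF₁ : ∀ e ∈ F₁, ∃ v ∈ N, ∃ a' ∉ N, e = s(v, a') := by
    intro e he
    obtain ⟨⟨v, a'⟩, hva, rfl⟩ := Finset.mem_image.1 he
    obtain ⟨hv, ha'⟩ := Finset.mem_product.1 hva
    exact ⟨v, hv, a', Finset.disjoint_left.1 hNA.symm (Finset.mem_of_mem_erase ha'), rfl⟩
  -- `F₁ ∪ Fa` is the full contact set `F` as a set of pairs
  have hUF : F₁ ∪ Fa = F := by
    ext e
    simp only [Finset.mem_union, hF₁def, hFadef, hFdef, Finset.mem_image, Finset.mem_product, Finset.mem_erase]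
    constructor
    · rintro (⟨⟨v, a'⟩, ⟨hv, -, ha'⟩, rfl⟩ | ⟨v, hv, rfl⟩)
      · exact ⟨(v, a'), ⟨hv, ha'⟩, rfl⟩
      · exact ⟨(v, a), ⟨hv, ha⟩, rfl⟩
    · rintro ⟨⟨v, a'⟩, ⟨hv, ha'⟩, rfl⟩
      by_cases haa : a' = a
      · subst haa; exact Or.inr ⟨v, hv, rfl⟩
      · exact Or.inl ⟨(v, a'), ⟨hv, haa, ha'⟩, rfl⟩
  -- the base `pinW g F ∅` and `q` give the same reliabilities off the block (as in `fingerML3_of_gluedWitness`)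
  have hFall : ∀ e ∈ F, ∃ v ∈ N, ∃ a' ∉ N, e = s(v, a') := by
    intro e he
    obtain ⟨⟨v, a'⟩, hva, rfl⟩ := Finset.mem_image.1 he
    obtain ⟨hv, ha'⟩ := Finset.mem_product.1 hva
    exact ⟨v, hv, a', Finset.disjoint_left.1 hNA.symm ha', rfl⟩
  set w₀ : Sym2 (Fin n) → unitInterval := pinW g (↑F : Set (Sym2 (Fin n))) ↑(∅ : Finset (Sym2 (Fin n))) with hw₀
  have hin : ∀ e : Sym2 (Fin n), (∀ z ∈ e, z ∉ N) → w₀ e = q e := by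
    intro e he
    have heF : e ∉ (↑F : Set (Sym2 (Fin n))) := by
      intro heF
      obtain ⟨v, hv, a', -, rfl⟩ := hFall e (Finset.mem_coe.1 heF)
      exact he v (Sym2.mem_mk_left v a') hv
    rw [hw₀, pinW_apply_of_not_mem g _ heF]
    have h1 : ¬ ((∀ y ∈ e, y ∈ N) ∧ ¬ e.IsDiag) := by
      induction e using Sym2.ind with
      | h u u' => exact fun h => he u (Sym2.mem_mk_left u u') (h.1 u (Sym2.mem_mk_left u u'))
    have h2 : ¬ (∃ y ∈ e, y ∈ N) := fun ⟨y, hy, hyN⟩ => he y hy hyN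
    simp only [hg, hq, h1, h2, if_false]
  have hw₀cut : ∀ u : Fin n, u ∉ N → ∀ v ∈ N, w₀ s(u, v) = 0 := by
    intro u hu v hv
    by_cases huA : u ∈ A
    · have he : s(u, v) ∈ (↑F : Set (Sym2 (Fin n))) := by
        refine Finset.mem_coe.2 (Finset.mem_image.2 ⟨(v, u), Finset.mem_product.2 ⟨hv, huA⟩, ?_⟩)
        exact Sym2.eq_swap
      rw [hw₀, pinW_apply_of_mem_of_not_mem g he (by simp)]
    · have he : s(u, v) ∉ (↑F : Set (Sym2 (Fin n))) := by
        intro heF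
        obtain ⟨⟨v', a'⟩, hva, he'⟩ := Finset.mem_image.1 (Finset.mem_coe.1 heF)
        obtain ⟨hv', ha'⟩ := Finset.mem_product.1 hva
        dsimp only at he'
        rcases Sym2.eq_iff.1 he' with ⟨h1, h2⟩ | ⟨h1, h2⟩
        · exact hu (h1 ▸ hv')
        · exact huA (h2 ▸ ha')
      rw [hw₀, pinW_apply_of_not_mem g _ he]
      have h1 : ¬ ((∀ y ∈ s(u, v), y ∈ N) ∧ ¬ (s(u, v)).IsDiag) := fun h => hu (h.1 u (Sym2.mem_mk_left u v))
      simp only [hg, h1, if_false]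
      have := hfree v hv u huA hu
      rw [Sym2.eq_swap]
      exact Subtype.ext (by exact_mod_cast this)
  have hqcut : ∀ u : Fin n, u ∉ N → ∀ v ∈ N, q s(u, v) = 0 := by
    intro u hu v hv
    have : ∃ y ∈ s(u, v), y ∈ N := ⟨v, Sym2.mem_mk_right u v, hv⟩
    simp only [hq, this, if_true]
  have hloc : ∀ y : Fin n, y ∉ N → (prodBernoulli w₀).real (openConn y b) = (prodBernoulli q).real (openConn y b) :=
    fun y hy => openConn_real_eq_offBlock w₀ q N b hy hin hw₀cut hqcut
  have hle' : (prodBernoulli (pinW g (↑(F₁ ∪ Fa) : Set (Sym2 (Fin n))) ↑(∅ : Finset (Sym2 (Fin n))))).real (openConn d b) ≤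
      (prodBernoulli (pinW g (↑(F₁ ∪ Fa) : Set (Sym2 (Fin n))) ↑(∅ : Finset (Sym2 (Fin n))))).real (openConn a b) := by
    rw [hUF, ← hw₀, hloc d hdN, hloc a haN]
    exact hle
  have hpin := fingerPeel_pinW_glue_eq K N haN
  have hii : (prodBernoulli (pinW g (↑Fa : Set (Sym2 (Fin n))) (∅ : Set (Sym2 (Fin n))))).real
        ({ω : Set (Sym2 (Fin n)) | ∃ e ∈ F₁, e ∈ ω} ∩ openConn d b) ≤
      (prodBernoulli (pinW g (↑Fa : Set (Sym2 (Fin n))) (∅ : Set (Sym2 (Fin n))))).real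
        ({ω : Set (Sym2 (Fin n)) | ∃ e ∈ F₁, e ∈ ω} ∩ ⋃ s ∈ N, openConn s b) := by
    rw [hpin, ← fingerContact_R_eq N (A.erase a)]
    exact hsub
  rw [fingerContact_R_eq_union N A ha]
  exact block_multiEdge_peel_base g N F₁ Fa a d b hF₁ hFa haN hdN hda hle' hii

end BasePeel

end

end Summit.CriticalPhenomena.PercolationContinuityZ3.Theorems
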